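import Summits.FinalStateConjecture.FinalStateConjecture.Theorems.EIHFluxBalanceInertialRecessionChartCalculus
import Literature.Geometry.Lorentzian.CauchyDevelopment
import Literature.Geometry.Lorentzian.ConvergenceTransport
import Literature.Geometry.Lorentzian.OpensCausality
import Literature.Geometry.Lorentzian.KerrHyperboloidalLeaves
import Literature.Geometry.Riemannian.RiemannianCoveringCriterion
import Literature.Geometry.Lorentzian.GeodesicProofs

/-!
# Crux `HonestFixedRadiusSettling` · line `sojourn-needs-only-one-over-delta` · stub `stub_farExit`
# Layer H2 (b): chart components of a flat chart; the data normal read in the chart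

Helper file for `stmt-FinalStateConjecture-13550` (stub `stub_farExit`). For a smooth chart map
`Φ : U → M` on an open `U ⊆ E4` into a spacetime `(M, g)`, the CHART COMPONENTS are
`G♭ y = (Φ^* g)_y`, realised as the genuine function
`y ↦ 𝓢.deviationExtend (Minkowski.backgroundOn U) Φ y + η : E4 → (E4 →L E4 →L ℝ)`
(the deviation from `η` extended by `0` off `U`, plus `η`). This file proves:
* `chartComponents_apply/symm`, `contDiffAt_chartComponents`: `G♭ y (v, w) = g(dΦ v, dΦ w)` on `U`,
  symmetry everywhere, smoothness on `U`; `isOpen_nondegLocus`: `{y ∈ U | G♭ y invertible}` is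
  open; `chartComponents_eq_of_mem_closure`: agreement with a continuous field on the closure of a
  set where they agree; nondegenerate forms on `E4` as invertible maps into the dual;
* `exists_normal_preimage` — **the data normal in the chart.** For a development `𝒟` of data on
  `X`, if near `x₀` the slice map `x ↦ Φ(0, x)` factors as `ι ∘ φ` through a smooth `φ` into the
  data manifold (`ι = 𝒟.embed`), and `dΦ_{(0,x₀)}` is injective, then the future unit normal
  `𝒟.normal (φ x₀)` is `dΦ n` for an `n ∈ E4` which is `G♭`-normal to the slice directions
  `(0, q)`, `G♭`-unit timelike, and has `G♭(n, e₀) < 0` as soon as `dΦ e₀` is future-directed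
  (differentiate `s ↦ Φ(0, x₀ + s q) = ι(φ(x₀ + s q))` at `s = 0`; O'Neill 1983, Ch. 4, p. 98 and
  Ch. 5, p. 145);
* `energy_pos_of_isFutureDirected` — a future-directed `v = dΦ w` pairs negatively with the
  future-directed timelike `dΦ e₀`: `−G♭(w, e₀) > 0` (O'Neill 1983, Ch. 5, Lemma 5.26 ff.).

References: B. O'Neill, *Semi-Riemannian geometry* (1983), Ch. 3, p. 58; Ch. 4, p. 98; Ch. 5,
pp. 141–145; R. M. Wald, *General Relativity* (1984), §10.2.
-/

set_option linter.dupNamespace false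

noncomputable section

open Literature.Geometry.Lorentzian
open scoped Manifold ContDiff Topology
open Bundle Filter Set Function TopologicalSpace

namespace Summit.FinalStateConjecture.FinalStateConjecture.Theorems.StarvedNecks.OneOverDelta.Transport

open Summit.FinalStateConjecture.FinalStateConjecture.Theorems

/-! ## Nondegenerate bilinear forms on `E4` as invertible maps into the dual -/

/-- `dim E4 = dim (E4 →L ℝ)`. [folklore] -/
theorem finrank_eq_finrank_dual : Module.finrank ℝ E4 = Module.finrank ℝ (E4 →L[ℝ] ℝ) := by
  rw [← LinearEquiv.finrank_eq (LinearMap.toContinuousLinearMap : (E4 →ₗ[ℝ] ℝ) ≃ₗ[ℝ] (E4 →L[ℝ] ℝ))]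
  exact Subspace.dual_finrank_eq.symm

/-- A nondegenerate bilinear form on `E4` is an invertible map `E4 → (E4 →L ℝ)`. [folklore] -/
theorem mem_range_of_nondegenerate (B : E4 →L[ℝ] E4 →L[ℝ] ℝ) (hB : ∀ u, (∀ v, B u v = 0) → u = 0) :
    B ∈ range ((↑) : (E4 ≃L[ℝ] (E4 →L[ℝ] ℝ)) → E4 →L[ℝ] (E4 →L[ℝ] ℝ)) := by
  have hinj : Injective (B : E4 →ₗ[ℝ] (E4 →L[ℝ] ℝ)) := by
    refine (injective_iff_map_eq_zero _).2 fun u hu ↦ hB u fun v ↦ ?_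
    have := congrArg (fun L : E4 →L[ℝ] ℝ ↦ L v) hu
    simpa using this
  refine ⟨((B : E4 →ₗ[ℝ] (E4 →L[ℝ] ℝ)).linearEquivOfInjective hinj
    finrank_eq_finrank_dual).toContinuousLinearEquiv, ?_⟩
  ext u v
  simp

/-- An invertible map `E4 → (E4 →L ℝ)` is a nondegenerate bilinear form. [folklore] -/
theorem nondegenerate_of_mem_range {B : E4 →L[ℝ] E4 →L[ℝ] ℝ}
    (hB : B ∈ range ((↑) : (E4 ≃L[ℝ] (E4 →L[ℝ] ℝ)) → E4 →L[ℝ] (E4 →L[ℝ] ℝ))) (u : E4)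
    (hu : ∀ v, B u v = 0) : u = 0 := by
  obtain ⟨e, rfl⟩ := hB
  have h1 : (e : E4 →L[ℝ] (E4 →L[ℝ] ℝ)) u = 0 := ContinuousLinearMap.ext fun v ↦ hu v
  rw [ContinuousLinearEquiv.coe_coe] at h1
  exact e.injective (by rw [h1, map_zero])

/-! ## The chart components of a smooth chart map -/

section Chart

variable {𝓢 : Spacetime 4} {U : Opens E4} {Φ : U → 𝓢.carrier}
  {Gc : E4 → E4 →L[ℝ] E4 →L[ℝ] ℝ}
  (hGc : Gc = fun y ↦ 𝓢.deviationExtend (Minkowski.backgroundOn U) Φ y + Minkowski.bilin)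
include hGc

/-- **The chart components are the pulled-back metric**: `G♭ y (v, w) = g(dΦ_y v, dΦ_y w)` for
`y ∈ U`. [folklore] -/
theorem chartComponents_apply (y : U) (v w : E4) :
    Gc y v w = 𝓢.metric.val (Φ y) (mfderiv 𝓘(ℝ, E4) (𝓡 4) Φ y v) (mfderiv 𝓘(ℝ, E4) (𝓡 4) Φ y w) := by
  subst hGc
  have e1 := 𝓢.deviationExtend_coe (Minkowski.backgroundOn U) Φ y
  simp only [FunLike.coe_add, Pi.add_apply]
  rw [show (y : E4) = (y : (Minkowski.backgroundOn U).domain).1 from rfl, e1,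
    Spacetime.deviation_apply]
  exact sub_add_cancel _ _

/-- The chart components are `C^∞` at every point of `U`. [folklore] -/
theorem contDiffAt_chartComponents (hΦ : ContMDiff 𝓘(ℝ, E4) (𝓡 4) ∞ Φ) (y : U) :
    ContDiffAt ℝ ∞ Gc y := by
  subst hGc
  exact (contDiffAt_deviationExtend_of_bilin 𝓢 (Minkowski.backgroundOn U) hΦ y contDiffAt_const).add
    contDiffAt_const

/-- The chart components are symmetric at every point of `E4` (off `U` they are `η`). [folklore] -/
theorem chartComponents_symm (y : E4) (v w : E4) : Gc y v w = Gc y w v := by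
  by_cases hy : y ∈ U
  · rw [chartComponents_apply hGc ⟨y, hy⟩, chartComponents_apply hGc ⟨y, hy⟩, 𝓢.metric.symm]
  · subst hGc
    simp only [FunLike.coe_add, Pi.add_apply]
    rw [𝓢.deviationExtend_of_not_mem (Minkowski.backgroundOn U) Φ
      (show y ∉ (Minkowski.backgroundOn U).domain from hy), Minkowski.bilin_symm]
    simp

/-- The chart components are continuous on `U`. [folklore] -/
theorem continuousOn_chartComponents (hΦ : ContMDiff 𝓘(ℝ, E4) (𝓡 4) ∞ Φ) :
    ContinuousOn Gc (U : Set E4) := fun y hy ↦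
  (contDiffAt_chartComponents hGc hΦ ⟨y, hy⟩).continuousAt.continuousWithinAt

/-- The nondegeneracy locus `W = {y ∈ U | G♭ y invertible}` is open. [folklore] -/
theorem isOpen_nondegLocus (hΦ : ContMDiff 𝓘(ℝ, E4) (𝓡 4) ∞ Φ) :
    IsOpen ((U : Set E4) ∩ Gc ⁻¹' range ((↑) : (E4 ≃L[ℝ] (E4 →L[ℝ] ℝ)) → E4 →L[ℝ] (E4 →L[ℝ] ℝ))) :=
  (continuousOn_chartComponents hGc hΦ).isOpen_inter_preimage U.2 ContinuousLinearEquiv.isOpen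

/-- **Agreement on the closure.** If `G♭ = G` on `Z` and `G` is continuous at a point `y ∈ U`
of the closure of `Z`, then `G♭ y = G y`. [folklore] -/
theorem chartComponents_eq_of_mem_closure (hΦ : ContMDiff 𝓘(ℝ, E4) (𝓡 4) ∞ Φ)
    {G : E4 → E4 →L[ℝ] E4 →L[ℝ] ℝ} {Z : Set E4} (hGZ : ∀ y ∈ Z, Gc y = G y) {y : E4} (hyU : y ∈ U)
    (hy : y ∈ closure Z) (hG : ContinuousAt G y) : Gc y = G y := by
  haveI : (𝓝[Z] y).NeBot := mem_closure_iff_nhdsWithin_neBot.1 hy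
  have h1 : Tendsto Gc (𝓝[Z] y) (𝓝 (Gc y)) :=
    ((contDiffAt_chartComponents hGc hΦ ⟨y, hyU⟩).continuousAt.tendsto).mono_left nhdsWithin_le_nhds
  have h2 : Tendsto G (𝓝[Z] y) (𝓝 (G y)) := hG.tendsto.mono_left nhdsWithin_le_nhds
  have h3 : Gc =ᶠ[𝓝[Z] y] G := eventually_nhdsWithin_of_forall hGZ
  exact tendsto_nhds_unique (h1.congr' h3) h2

/-- **A future-directed `v = dΦ w` has positive energy against `dΦ e₀`**: if `dΦ_y e₀` is
future-directed and `G♭ y (e₀, e₀) < 0`, and `dΦ_y w` is future-directed, then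
`−G♭ y (w, e₀) > 0`. [cite: ONeillSemiRiemannian1983, Ch. 5, Lemma 5.29 ff. (pp. 143–144)] -/
theorem energy_pos_of_isFutureDirected (y : U) {w : E4}
    (hT : 𝓢.timeOrientation.IsFutureDirected (mfderiv 𝓘(ℝ, E4) (𝓡 4) Φ y (E4.basisVector 0)))
    (hTt : Gc y (E4.basisVector 0) (E4.basisVector 0) < 0)
    (hv : 𝓢.timeOrientation.IsFutureDirected (mfderiv 𝓘(ℝ, E4) (𝓡 4) Φ y w)) :
    0 < -(Gc y w (E4.basisVector 0)) := by
  rw [chartComponents_apply hGc] at hTt ⊢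
  have h := TimeOrientation.IsFutureDirected.val_lt_zero _ hT hTt hv
  rw [𝓢.metric.symm] at h
  linarith

omit hGc in
/-- **Deciding theorem of this helper file (registered stub `farExit_chartComponents_symm`)**: the
chart components are symmetric everywhere, `chartComponents_symm` with explicit binders. [folklore] -/
theorem farExit_chartComponents_symm : ∀ (𝓢 : Spacetime 4) (U : TopologicalSpace.Opens E4) (Φ : U → 𝓢.carrier) (y v w : E4), (𝓢.deviationExtend (Minkowski.backgroundOn U) Φ y + Minkowski.bilin) v w = (𝓢.deviationExtend (Minkowski.backgroundOn U) Φ y + Minkowski.bilin) w v :=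
  fun _ _ _ y v w ↦ chartComponents_symm rfl y v w

end Chart

/-! ## The data normal read in the chart -/

section Normal

variable {X : Type} [TopologicalSpace X] [ChartedSpace E3 X] [IsManifold (𝓡 3) ∞ X]
  [ConnectedSpace X] {D : InitialDataSet (𝓡 3) X}

/-- Velocities of curves in an open subset of `E4` are derivatives of the coordinate curve.
[folklore] -/
theorem velocity_opens_eq_deriv (U : Opens E4) (u : ℝ → U) (t : ℝ) :
    (velocity 𝓘(ℝ, E4) u t : E4) = deriv (fun s ↦ (u s : E4)) t := by
  rw [← velocity_subtypeVal_comp (I := 𝓘(ℝ, E4)) U u t]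
  unfold velocity
  rw [mfderiv_eq_fderiv]
  rfl

/-- **The data normal in the chart** (module docstring). [cite: ONeill1983, Ch. 4, p. 98] -/
theorem exists_normal_preimage (𝒟 : VacuumCauchyDevelopment D) {U : Opens E4}
    {Φ : U → 𝒟.carrier} (hΦ : ContMDiff 𝓘(ℝ, E4) (𝓡 4) ∞ Φ) {Gc : E4 → E4 →L[ℝ] E4 →L[ℝ] ℝ}
    (hGc : Gc = fun y ↦ 𝒟.toSpacetime.deviationExtend (Minkowski.backgroundOn U) Φ y + Minkowski.bilin)
    {V : Opens E3} {φ : V → X} (hφ : ContMDiff 𝓘(ℝ, E3) (𝓡 3) ∞ φ) {x₀ : V}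
    (hy₀U : E4.ofTimeSpace 0 (x₀ : E3) ∈ U)
    (hloc : ∀ᶠ x : V in 𝓝 x₀, ∃ hx : E4.ofTimeSpace 0 (x : E3) ∈ U, Φ ⟨_, hx⟩ = 𝒟.embed (φ x))
    (hinj : Injective (mfderiv 𝓘(ℝ, E4) (𝓡 4) Φ ⟨_, hy₀U⟩)) :
    ∃ n : E4, mfderiv 𝓘(ℝ, E4) (𝓡 4) Φ ⟨_, hy₀U⟩ n = 𝒟.normal (φ x₀) ∧
      (∀ q : E3, Gc (E4.ofTimeSpace 0 x₀) n (E4.ofTimeSpace 0 q) = 0) ∧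
      Gc (E4.ofTimeSpace 0 x₀) n n = -1 ∧
      (𝒟.timeOrientation.IsFutureDirected (mfderiv 𝓘(ℝ, E4) (𝓡 4) Φ ⟨_, hy₀U⟩ (E4.basisVector 0)) →
        Gc (E4.ofTimeSpace 0 x₀) n (E4.basisVector 0) < 0) := by
  classical
  set y₀U : U := ⟨_, hy₀U⟩ with hy₀U_def
  set p : X := φ x₀ with hp
  obtain ⟨⟨hNorm, hUnit⟩, hFut⟩ := 𝒟.isFutureUnitNormal
  -- the base points agree
  have hbase : Φ y₀U = 𝒟.embed p := by
    obtain ⟨hx, h⟩ := hloc.self_of_nhds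
    exact h
  have hval : ∀ A B : E4, 𝒟.metric.val (Φ y₀U) A B = 𝒟.metric.val (𝒟.embed p) A B := by
    have key : ∀ (x₁ x₂ : 𝒟.carrier), x₁ = x₂ → ∀ A B : E4,
        𝒟.metric.val x₁ A B = 𝒟.metric.val x₂ A B := by
      intro x₁ x₂ h A B; subst h; rfl
    exact key _ _ hbase
  -- `dΦ` is bijective at `y₀`
  have hbij := mfderiv_bijective_of_injective (I := 𝓡 4) (I' := 𝓘(ℝ, E4)) hinj rfl
  obtain ⟨n, hn⟩ := hbij.2 (𝒟.normal p)
  refine ⟨n, hn, fun q ↦ ?_, ?_, fun hfut ↦ ?_⟩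
  · -- differentiate `s ↦ Φ(0, x₀ + s q) = ι (φ (x₀ + s q))` at `s = 0`
    set cE : ℝ → E3 := fun s ↦ (x₀ : E3) + s • q with hcE
    have hcE0 : cE 0 = x₀ := by simp [hcE]
    have hcEc : Continuous cE := by fun_prop
    have hcEd : ∀ s, HasDerivAt cE q s := fun s ↦ by
      have h := ((hasDerivAt_id s).smul_const q).const_add (x₀ : E3)
      rw [one_smul] at h
      exact h
    -- the curve in `V`
    set cV : ℝ → V := fun s ↦ if h : cE s ∈ V then ⟨cE s, h⟩ else x₀ with hcV
    have hVmem : ∀ᶠ s in 𝓝 (0 : ℝ), cE s ∈ V :=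
      hcEc.continuousAt.preimage_mem_nhds (by rw [hcE0]; exact V.2.mem_nhds x₀.2)
    have hcV_eq : ∀ᶠ s in 𝓝 (0 : ℝ), (cV s : E3) = cE s := by
      filter_upwards [hVmem] with s hs
      simp [hcV, hs]
    have hcV0 : cV 0 = x₀ := by
      have : cE 0 ∈ V := by rw [hcE0]; exact x₀.2
      simp only [hcV, this, dif_pos]
      exact Subtype.ext hcE0
    have hcVt : Tendsto cV (𝓝 0) (𝓝 x₀) := by
      rw [← hcV0]
      refine ContinuousAt.tendsto ?_
      have hcVc : ContinuousAt (fun s ↦ (cV s : E3)) 0 :=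
        hcEc.continuousAt.congr (Filter.EventuallyEq.symm hcV_eq)
      exact (Topology.IsInducing.subtypeVal.continuousAt_iff).2 hcVc
    have hcVd : MDifferentiableAt 𝓘(ℝ, ℝ) 𝓘(ℝ, E3) cV 0 := by
      rw [← mdifferentiableAt_subtypeVal_comp_curve_iff (I := 𝓘(ℝ, E3)) V]
      refine MDifferentiableAt.congr_of_eventuallyEq ?_ (hcV_eq.mono fun s hs ↦ hs)
      exact mdifferentiableAt_iff_differentiableAt.2 (hcEd 0).differentiableAt
    -- the curve in `U`
    set cU : ℝ → U := fun s ↦ if h : E4.ofTimeSpace 0 (cE s) ∈ U then ⟨_, h⟩ else y₀U with hcU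
    have hUmem : ∀ᶠ s in 𝓝 (0 : ℝ), E4.ofTimeSpace 0 (cE s) ∈ U :=
      ((E4.continuous_ofTimeSpace 0).comp hcEc).continuousAt.preimage_mem_nhds
        (by rw [Function.comp_apply, hcE0]; exact U.2.mem_nhds hy₀U)
    have hcU_eq : ∀ᶠ s in 𝓝 (0 : ℝ), (cU s : E4) = E4.ofTimeSpace 0 (cE s) := by
      filter_upwards [hUmem] with s hs
      simp [hcU, hs]
    have hcU0 : cU 0 = y₀U := by
      have : E4.ofTimeSpace 0 (cE 0) ∈ U := by rw [hcE0]; exact hy₀U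
      simp only [hcU, this, dif_pos]
      exact Subtype.ext (by simp [hcE0, hy₀U_def])
    have hcUd' : HasDerivAt (fun s ↦ E4.ofTimeSpace 0 (cE s)) (E4.ofTimeSpace 0 q) 0 := by
      have := (E4.hasFDerivAt_ofTimeSpace 0 (cE 0)).comp_hasDerivAt 0 (hcEd 0)
      exact this
    have hcUd : MDifferentiableAt 𝓘(ℝ, ℝ) 𝓘(ℝ, E4) cU 0 := by
      rw [← mdifferentiableAt_subtypeVal_comp_curve_iff (I := 𝓘(ℝ, E4)) U]
      refine MDifferentiableAt.congr_of_eventuallyEq ?_ (hcU_eq.mono fun s hs ↦ hs)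
      exact mdifferentiableAt_iff_differentiableAt.2 hcUd'.differentiableAt
    have hvelU : (velocity 𝓘(ℝ, E4) cU 0 : E4) = E4.ofTimeSpace 0 q := by
      rw [velocity_opens_eq_deriv, Filter.EventuallyEq.deriv_eq hcU_eq]
      exact hcUd'.deriv
    -- the two spacetime curves agree near `0`
    have hagree : (fun s ↦ Φ (cU s)) =ᶠ[𝓝 0] fun s ↦ 𝒟.embed (φ (cV s)) := by
      have h1 := hcVt.eventually hloc
      filter_upwards [h1, hcU_eq, hcV_eq] with s hs hsU hsV
      obtain ⟨hx, hx'⟩ := hs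
      have e : cU s = ⟨_, hx⟩ := Subtype.ext (by
        show (cU s : E4) = E4.ofTimeSpace 0 (cV s : E3)
        rw [hsU, hsV])
      rw [e, hx']
    -- velocities
    have hΦd : MDifferentiableAt 𝓘(ℝ, E4) (𝓡 4) Φ (cU 0) := (hΦ _).mdifferentiableAt (by simp)
    have hιd : MDifferentiableAt (𝓡 3) (𝓡 4) 𝒟.embed (φ (cV 0)) :=
      (𝒟.isSmoothEmbedding.contMDiff _).mdifferentiableAt (by simp)
    have hφcd : MDifferentiableAt 𝓘(ℝ, ℝ) (𝓡 3) (fun s ↦ φ (cV s)) 0 :=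
      ((hφ _).mdifferentiableAt (by simp)).comp 0 hcVd
    have hv1 : velocity (𝓡 4) (fun s ↦ Φ (cU s)) 0 =
        mfderiv 𝓘(ℝ, E4) (𝓡 4) Φ (cU 0) (velocity 𝓘(ℝ, E4) cU 0) :=
      Literature.Geometry.Riemannian.CartanHadamard.velocity_comp_apply hΦd hcUd
    have hv2 : velocity (𝓡 4) (fun s ↦ 𝒟.embed (φ (cV s))) 0 =
        mfderiv (𝓡 3) (𝓡 4) 𝒟.embed (φ (cV 0)) (velocity (𝓡 3) (fun s ↦ φ (cV s)) 0) :=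
      Literature.Geometry.Riemannian.CartanHadamard.velocity_comp_apply hιd hφcd
    have hv12 := velocity_congr_of_eventuallyEq (I := 𝓡 4) hagree.symm
    -- the normality
    have hN0 : 𝒟.metric.val (𝒟.embed p) (𝒟.normal p)
        (mfderiv (𝓡 3) (𝓡 4) 𝒟.embed (φ (cV 0)) (velocity (𝓡 3) (fun s ↦ φ (cV s)) 0)) = 0 := by
      have := hNorm (φ (cV 0)) (velocity (𝓡 3) (fun s ↦ φ (cV s)) 0)
      rw [hcV0] at this ⊢
      exact this
    rw [chartComponents_apply hGc y₀U, hval, hn]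
    have e2 : (mfderiv 𝓘(ℝ, E4) (𝓡 4) Φ y₀U (E4.ofTimeSpace 0 q) : E4) =
        mfderiv (𝓡 3) (𝓡 4) 𝒟.embed (φ (cV 0)) (velocity (𝓡 3) (fun s ↦ φ (cV s)) 0) := by
      rw [← hv2, hv12, hv1, hvelU, hcU0]
    rw [e2]
    exact hN0
  · rw [chartComponents_apply hGc y₀U, hval, hn]
    exact hUnit p
  · rw [chartComponents_apply hGc y₀U, hval, hn]
    have hTt : 𝒟.metric.IsTimelike (𝒟.normal p) := by
      show 𝒟.metric.val _ _ _ < 0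
      rw [hUnit p]; norm_num
    have hfut' : 𝒟.timeOrientation.IsFutureDirected
        (show TangentSpace (𝓡 4) (𝒟.embed p) from mfderiv 𝓘(ℝ, E4) (𝓡 4) Φ y₀U (E4.basisVector 0)) := by
      obtain ⟨⟨h1, h2⟩, h3⟩ := hfut
      refine ⟨⟨?_, h2⟩, ?_⟩
      · rw [← hval]; exact h1
      · have key : ∀ (x₁ x₂ : 𝒟.carrier), x₁ = x₂ → ∀ A : E4,
            𝒟.metric.val x₁ (𝒟.timeOrientation.vectorField x₁) A =
              𝒟.metric.val x₂ (𝒟.timeOrientation.vectorField x₂) A := by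
          intro x₁ x₂ h A; subst h; rfl
        rw [← key _ _ hbase]; exact h3
    exact TimeOrientation.IsFutureDirected.val_lt_zero _ (hFut p) hTt hfut'

end Normal

end Summit.FinalStateConjecture.FinalStateConjecture.Theorems.StarvedNecks.OneOverDelta.Transport

end
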